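import Summits.HubbardSuperconductivity.HubbardSuperconductivity.Theses.CooperSharpness
/-!
# Route `CooperSharpness` — crux-strategist split of the deciding crux `CooperCoordinateGrowth`
(stmt-HubbardSuperconductivity-12848); closes BY NAME the glue items `CooperCoordinateGrowthOfSubs`
(stmt-HubbardSuperconductivity-19071) and `SharpnessDichotomyOfSubs` (stmt-HubbardSuperconductivity-19072) of route file rev 7

Typed decomposition `CooperThreshold ∧ IncipientOrderPropagation ∧ LocalConvexStep → CooperCoordinateGrowth`
(BC2 redirect of the route re-audit). The three pieces are physically distinct mechanisms:

* `CooperThreshold` (the route's rank-3 crux, by name): Kohn–Luttinger supercriticality — the torus `d`-wave pair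
  susceptibility per site of EVERY sector ground state of `H_L(U,g₀) = hubbardTorus 2 L 1 U − g₀·Σ_x P_xᴴP_x`
  diverges along even `L` at one repulsive-shifted local pair coupling `g₀ < 0` (weak coupling, any `γ`-window).
* `IncipientOrderPropagation` (piece R = the route's rank-5 crux, stmt-19057):
  SHARPNESS IN WEAK FORM — an every-ground-state divergence at `g₀` forces, for every `Δ > 0`, all large even `L`
  and every coupling `g ∈ [g₀ + Δ, 0]`, order density `θ_L(ψ) = L⁻⁴ Re⟨ψ, pFᴴ pF ψ⟩ ≥ 1/L` for EVERY normalised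
  sector ground state (no intermediate phase to the right of a divergent-susceptibility point; junk-free: only the
  order density appears in the conclusion). Transplant of Aizenman–Barsky / Duminil-Copin–Tassion sharpness.
* `LocalConvexStep` (piece V = the route's rank-6 crux, stmt-19058): BCS CONVEXITY OVER SHORT
  COUPLING STEPS — there is a step length `s > 0` such that on every `[g₂, g₃] ⊆ [−γ, 0]` with `g₃ ≤ g₂ + s` on which
  every ground state is incipiently ordered (`θ_L ≥ 1/L`), for every normalised sector ground state `ψ₃` at `g₃` some
  normalised sector ground state `ψ₂` at `g₂` has `κ̃(ψ₂) + b (g₃ − g₂) ≤ κ̃(ψ₃) + η_L`, `κ̃ = −1/log(θ/64)`, `η_L → 0`.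

ASSEMBLY (this file, sorry-free): the local step is TELESCOPED over a partition of `[g₂, g₃] ⊆ [g₀/2, 0]` into
`⌈|g₀|/(2s)⌉` steps (induction on the number of steps, composing the `∀ψ₃ ∃ψ₂` relation through the intermediate
ground states, accumulating slack `k·|η_L|`), the incipient-order premise of each step being discharged on `[g₀/2, 0]`
by the propagation (with `Δ = |g₀|/2`) fed with the threshold's divergence; the new slack `⌈|g₀|/(2s)⌉·|η_L| → 0`.
The same argument derives the route's rank-2 crux `SharpnessDichotomy` from R and V (`sharpnessDichotomy_of_subs`).

Sources: M. Aizenman, D. J. Barsky, Comm. Math. Phys. 108 (1987) 489 (sharpness: no intermediate phase + mean-field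
bound by integrating a differential inequality); H. Duminil-Copin, V. Tassion, Comm. Math. Phys. 343 (2016) 725;
D. J. Scalapino, Phys. Rep. 250 (1995) 329 §2 (the `d`-wave pair-field order parameter); S. Raghu, S. A. Kivelson,
D. J. Scalapino, PRB 81 (2010) 224505 (weak-coupling BCS/Kohn–Luttinger gap equation: `−1/log θ` affine in the
coupling). No new definitions; pure logic and real bookkeeping over the route's declarations.
-/

-- the mandated namespace `Summit.<Summit>.<Problem>.Theorems` repeats `HubbardSuperconductivity`
-- (single-problem summit, D-0017), which the `dupNamespace` linter flags on every declaration
set_option linter.dupNamespace false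

namespace Summit.HubbardSuperconductivity.HubbardSuperconductivity.Theorems.CooperSharpness

open Summit.HubbardSuperconductivity.HubbardSuperconductivity.Theses.CooperSharpness

/-- ABSTRACT TELESCOPING (the assembly's analytic core): a one-step growth relation `∀ψ₃ ∃ψ₂` with additive slack `e`
over steps of length `≤ s` inside `[a, c]` composes along any subinterval of length `≤ k·s` with slack `k·|e|`.
Induction on `k`; the `∀∃` relation is composed through the intermediate ground state. [folklore] -/
theorem split_telescope {S : Type*} (P : ℝ → S → Prop) (κ : S → ℝ) {a c s b e : ℝ} (hs : 0 < s)
    (hstep : ∀ g₂ g₃ : ℝ, a ≤ g₂ → g₂ ≤ g₃ → g₃ ≤ c → g₃ ≤ g₂ + s →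
      ∀ ψ₃ : S, P g₃ ψ₃ → ∃ ψ₂ : S, P g₂ ψ₂ ∧ κ ψ₂ + b * (g₃ - g₂) ≤ κ ψ₃ + e) :
    ∀ (k : ℕ) (g₂ g₃ : ℝ), a ≤ g₂ → g₂ ≤ g₃ → g₃ ≤ c → g₃ - g₂ ≤ k * s →
      ∀ ψ₃ : S, P g₃ ψ₃ → ∃ ψ₂ : S, P g₂ ψ₂ ∧ κ ψ₂ + b * (g₃ - g₂) ≤ κ ψ₃ + k * |e| := by
  intro k
  induction k with
  | zero =>
    intro g₂ g₃ _ h23 _ hlen ψ₃ hP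
    have h0 : g₃ = g₂ := by
      have : g₃ - g₂ ≤ 0 := by simpa using hlen
      linarith
    subst h0
    exact ⟨ψ₃, hP, by simp⟩
  | succ k ih =>
    intro g₂ g₃ ha h23 hc hlen ψ₃ hP
    have hk : ((k + 1 : ℕ) : ℝ) * |e| = (k : ℝ) * |e| + |e| := by
      push_cast
      ring
    have hk0 : (0 : ℝ) ≤ (k : ℝ) * |e| := by positivity
    by_cases h1 : g₃ ≤ g₂ + s
    · obtain ⟨ψ₂, hP₂, hκ⟩ := hstep g₂ g₃ ha h23 hc h1 ψ₃ hP
      refine ⟨ψ₂, hP₂, ?_⟩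
      have he : e ≤ |e| := le_abs_self e
      linarith
    · push Not at h1
      -- split at the intermediate coupling `g₂ + s`
      have hmid₁ : a ≤ g₂ + s := by linarith
      have hmid₂ : g₂ + s ≤ g₃ := le_of_lt h1
      have hmid₃ : g₃ - (g₂ + s) ≤ k * s := by
        have : g₃ - g₂ ≤ (k + 1 : ℝ) * s := by exact_mod_cast hlen
        linarith
      obtain ⟨ψm, hPm, hκm⟩ := ih (g₂ + s) g₃ hmid₁ hmid₂ hc hmid₃ ψ₃ hP
      obtain ⟨ψ₂, hP₂, hκ₂⟩ := hstep g₂ (g₂ + s) ha (by linarith) (by linarith) le_rfl ψm hPm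
      refine ⟨ψ₂, hP₂, ?_⟩
      have he : e ≤ |e| := le_abs_self e
      have : κ ψ₂ + b * (g₃ - g₂) = (κ ψ₂ + b * (g₂ + s - g₂)) + b * (g₃ - (g₂ + s)) := by ring
      linarith

/-- Concrete core: incipient order on `[a, 0]` (all large `L`) + the local convex step on `[lo, 0] ⊇ [a, 0]` give the
growth law on every subinterval of `[a, 0]` with slack `⌈(-a)/s⌉₊ · |η_L|`. [folklore] -/
theorem split_growth_core (U δ lo a s b : ℝ) (η : ℕ → ℝ) (L₀ L₁ : ℕ) (hlo : lo ≤ a) (hs : 0 < s)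
    (hinc : ∀ (L : ℕ) [NeZero L], L₁ ≤ L → Even L → ∀ g : ℝ, a ≤ g → g ≤ 0 → ∀ ψ : Literature.MathematicalPhysics.QuantumLattice.Fock (Literature.MathematicalPhysics.QuantumLattice.Orb (Literature.MathematicalPhysics.QuantumLattice.FermionTorus 2 L)), star ψ ⬝ᵥ ψ = 1 → Literature.MathematicalPhysics.QuantumLattice.IsGroundStateInSector (Literature.MathematicalPhysics.QuantumLattice.hubbardTorus 2 L 1 U - ((g : ℝ) : ℂ) • (∑ x : Literature.Probability.LatticeModels.TorusSite 2 L, Matrix.conjTranspose (Literature.MathematicalPhysics.QuantumLattice.localPair Literature.MathematicalPhysics.QuantumLattice.dWaveFormFactor L x) * Literature.MathematicalPhysics.QuantumLattice.localPair Literature.MathematicalPhysics.QuantumLattice.dWaveFormFactor L x)) (2 * ⌊(1 - δ) * (L : ℝ) ^ 2 / 2⌋₊) 0 ψ → 1 / (L : ℝ) ≤ ((Literature.MathematicalPhysics.QuantumLattice.expect (Matrix.conjTranspose (Literature.MathematicalPhysics.QuantumLattice.pairField Literature.MathematicalPhysics.QuantumLattice.dWaveFormFactor L) * Literature.MathematicalPhysics.QuantumLattice.pairField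 Literature.MathematicalPhysics.QuantumLattice.dWaveFormFactor L) ψ).re / (L : ℝ) ^ 4))
    (hV : ∀ (L : ℕ) [NeZero L], L₀ ≤ L → Even L → ∀ g₂ g₃ : ℝ, lo ≤ g₂ → g₂ ≤ g₃ → g₃ ≤ 0 → g₃ ≤ g₂ + s → (∀ g : ℝ, g₂ ≤ g → g ≤ g₃ → ∀ ψ : Literature.MathematicalPhysics.QuantumLattice.Fock (Literature.MathematicalPhysics.QuantumLattice.Orb (Literature.MathematicalPhysics.QuantumLattice.FermionTorus 2 L)), star ψ ⬝ᵥ ψ = 1 → Literature.MathematicalPhysics.QuantumLattice.IsGroundStateInSector (Literature.MathematicalPhysics.QuantumLattice.hubbardTorus 2 L 1 U - ((g : ℝ) : ℂ) • (∑ x : Literature.Probability.LatticeModels.TorusSite 2 L, Matrix.conjTranspose (Literature.MathematicalPhysics.QuantumLattice.localPair Literature.MathematicalPhysics.QuantumLattice.dWaveFormFactor L x) * Literature.MathematicalPhysics.QuantumLattice.localPair Literature.MathematicalPhysics.QuantumLattice.dWaveFormFactor L x)) (2 * ⌊(1 - δ) * (L : ℝ) ^ 2 / 2⌋₊) 0 ψ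 → 1 / (L : ℝ) ≤ ((Literature.MathematicalPhysics.QuantumLattice.expect (Matrix.conjTranspose (Literature.MathematicalPhysics.QuantumLattice.pairField Literature.MathematicalPhysics.QuantumLattice.dWaveFormFactor L) * Literature.MathematicalPhysics.QuantumLattice.pairField Literature.MathematicalPhysics.QuantumLattice.dWaveFormFactor L) ψ).re / (L : ℝ) ^ 4)) → ∀ ψ₃ : Literature.MathematicalPhysics.QuantumLattice.Fock (Literature.MathematicalPhysics.QuantumLattice.Orb (Literature.MathematicalPhysics.QuantumLattice.FermionTorus 2 L)), star ψ₃ ⬝ᵥ ψ₃ = 1 → Literature.MathematicalPhysics.QuantumLattice.IsGroundStateInSector (Literature.MathematicalPhysics.QuantumLattice.hubbardTorus 2 L 1 U - ((g₃ : ℝ) : ℂ) • (∑ x : Literature.Probability.LatticeModels.TorusSite 2 L, Matrix.conjTranspose (Literature.MathematicalPhysics.QuantumLattice.localPair Literature.MathematicalPhysics.QuantumLattice.dWaveFormFactor L x) * Literature.MathematicalPhysics.QuantumLattice.localPair Literature.MathematicalPhysics.QuantumLattice.dWaveFormFactor L x)) (2 * ⌊(1 - δ) * (L : ℝ) ^ 2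 / 2⌋₊) 0 ψ₃ → ∃ ψ₂ : Literature.MathematicalPhysics.QuantumLattice.Fock (Literature.MathematicalPhysics.QuantumLattice.Orb (Literature.MathematicalPhysics.QuantumLattice.FermionTorus 2 L)), star ψ₂ ⬝ᵥ ψ₂ = 1 ∧ Literature.MathematicalPhysics.QuantumLattice.IsGroundStateInSector (Literature.MathematicalPhysics.QuantumLattice.hubbardTorus 2 L 1 U - ((g₂ : ℝ) : ℂ) • (∑ x : Literature.Probability.LatticeModels.TorusSite 2 L, Matrix.conjTranspose (Literature.MathematicalPhysics.QuantumLattice.localPair Literature.MathematicalPhysics.QuantumLattice.dWaveFormFactor L x) * Literature.MathematicalPhysics.QuantumLattice.localPair Literature.MathematicalPhysics.QuantumLattice.dWaveFormFactor L x)) (2 * ⌊(1 - δ) * (L : ℝ) ^ 2 / 2⌋₊) 0 ψ₂ ∧ (-1 / Real.log (((Literature.MathematicalPhysics.QuantumLattice.expect (Matrix.conjTranspose (Literature.MathematicalPhysics.QuantumLattice.pairField Literature.MathematicalPhysics.QuantumLattice.dWaveFormFactor L) * Literature.MathematicalPhysics.QuantumLattice.pairField Literature.MathematicalPhysics.QuantumLattice.dWaveFormFactor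 L) ψ₂).re / (L : ℝ) ^ 4) / 64)) + b * (g₃ - g₂) ≤ (-1 / Real.log (((Literature.MathematicalPhysics.QuantumLattice.expect (Matrix.conjTranspose (Literature.MathematicalPhysics.QuantumLattice.pairField Literature.MathematicalPhysics.QuantumLattice.dWaveFormFactor L) * Literature.MathematicalPhysics.QuantumLattice.pairField Literature.MathematicalPhysics.QuantumLattice.dWaveFormFactor L) ψ₃).re / (L : ℝ) ^ 4) / 64)) + η L) :
    ∀ (L : ℕ) [NeZero L], max L₀ L₁ ≤ L → Even L → ∀ g₂ g₃ : ℝ, a ≤ g₂ → g₂ ≤ g₃ → g₃ ≤ 0 → ∀ ψ₃ : Literature.MathematicalPhysics.QuantumLattice.Fock (Literature.MathematicalPhysics.QuantumLattice.Orb (Literature.MathematicalPhysics.QuantumLattice.FermionTorus 2 L)), star ψ₃ ⬝ᵥ ψ₃ = 1 → Literature.MathematicalPhysics.QuantumLattice.IsGroundStateInSector (Literature.MathematicalPhysics.QuantumLattice.hubbardTorus 2 L 1 U - ((g₃ : ℝ) : ℂ) • (∑ x : Literature.Probability.LatticeModels.TorusSite 2 L, Matrix.conjTranspose (Literature.MathematicalPhysics.QuantumLattice.localPair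 Literature.MathematicalPhysics.QuantumLattice.dWaveFormFactor L x) * Literature.MathematicalPhysics.QuantumLattice.localPair Literature.MathematicalPhysics.QuantumLattice.dWaveFormFactor L x)) (2 * ⌊(1 - δ) * (L : ℝ) ^ 2 / 2⌋₊) 0 ψ₃ → ∃ ψ₂ : Literature.MathematicalPhysics.QuantumLattice.Fock (Literature.MathematicalPhysics.QuantumLattice.Orb (Literature.MathematicalPhysics.QuantumLattice.FermionTorus 2 L)), star ψ₂ ⬝ᵥ ψ₂ = 1 ∧ Literature.MathematicalPhysics.QuantumLattice.IsGroundStateInSector (Literature.MathematicalPhysics.QuantumLattice.hubbardTorus 2 L 1 U - ((g₂ : ℝ) : ℂ) • (∑ x : Literature.Probability.LatticeModels.TorusSite 2 L, Matrix.conjTranspose (Literature.MathematicalPhysics.QuantumLattice.localPair Literature.MathematicalPhysics.QuantumLattice.dWaveFormFactor L x) * Literature.MathematicalPhysics.QuantumLattice.localPair Literature.MathematicalPhysics.QuantumLattice.dWaveFormFactor L x)) (2 * ⌊(1 - δ) * (L : ℝ) ^ 2 / 2⌋₊) 0 ψ₂ ∧ (-1 / Real.log (((Literature.MathematicalPhysics.QuantumLattice.expect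 (Matrix.conjTranspose (Literature.MathematicalPhysics.QuantumLattice.pairField Literature.MathematicalPhysics.QuantumLattice.dWaveFormFactor L) * Literature.MathematicalPhysics.QuantumLattice.pairField Literature.MathematicalPhysics.QuantumLattice.dWaveFormFactor L) ψ₂).re / (L : ℝ) ^ 4) / 64)) + b * (g₃ - g₂) ≤ (-1 / Real.log (((Literature.MathematicalPhysics.QuantumLattice.expect (Matrix.conjTranspose (Literature.MathematicalPhysics.QuantumLattice.pairField Literature.MathematicalPhysics.QuantumLattice.dWaveFormFactor L) * Literature.MathematicalPhysics.QuantumLattice.pairField Literature.MathematicalPhysics.QuantumLattice.dWaveFormFactor L) ψ₃).re / (L : ℝ) ^ 4) / 64)) + (⌈(-a) / s⌉₊ : ℝ) * |η L| := by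
  intro L _ hL hEven g₂ g₃ h2 h23 h3 ψ₃ hn3 hgs3
  have hL₀ : L₀ ≤ L := le_of_max_le_left hL
  have hL₁ : L₁ ≤ L := le_of_max_le_right hL
  have key := split_telescope (c := (0:ℝ)) (b := b) (e := η L)
    (fun (g : ℝ) (ψ : Literature.MathematicalPhysics.QuantumLattice.Fock (Literature.MathematicalPhysics.QuantumLattice.Orb (Literature.MathematicalPhysics.QuantumLattice.FermionTorus 2 L))) => star ψ ⬝ᵥ ψ = 1 ∧ Literature.MathematicalPhysics.QuantumLattice.IsGroundStateInSector (Literature.MathematicalPhysics.QuantumLattice.hubbardTorus 2 L 1 U - ((g : ℝ) : ℂ) • (∑ x : Literature.Probability.LatticeModels.TorusSite 2 L, Matrix.conjTranspose (Literature.MathematicalPhysics.QuantumLattice.localPair Literature.MathematicalPhysics.QuantumLattice.dWaveFormFactor L x) * Literature.MathematicalPhysics.QuantumLattice.localPair Literature.MathematicalPhysics.QuantumLattice.dWaveFormFactor L x)) (2 * ⌊(1 - δ) * (L : ℝ) ^ 2 / 2⌋₊) 0 ψ)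
    (fun ψ => (-1 / Real.log (((Literature.MathematicalPhysics.QuantumLattice.expect (Matrix.conjTranspose (Literature.MathematicalPhysics.QuantumLattice.pairField Literature.MathematicalPhysics.QuantumLattice.dWaveFormFactor L) * Literature.MathematicalPhysics.QuantumLattice.pairField Literature.MathematicalPhysics.QuantumLattice.dWaveFormFactor L) ψ).re / (L : ℝ) ^ 4) / 64))) hs
    (by
      intro p q hp hpq hq hqs φ hφ
      obtain ⟨φ₂, h1, h2', h3'⟩ := hV L hL₀ hEven p q (le_trans hlo hp) hpq hq hqs
        (fun g hg1 hg2 ψ hψ hg => hinc L hL₁ hEven g (le_trans hp hg1) (le_trans hg2 hq) ψ hψ hg) φ hφ.1 hφ.2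
      exact ⟨φ₂, ⟨h1, h2'⟩, h3'⟩)
  have hlen : g₃ - g₂ ≤ (⌈(-a) / s⌉₊ : ℝ) * s := by
    have hc : (-a) / s ≤ (⌈(-a) / s⌉₊ : ℝ) := Nat.le_ceil _
    have : -a ≤ (⌈(-a) / s⌉₊ : ℝ) * s := by
      rw [div_le_iff₀ hs] at hc
      exact hc
    linarith
  obtain ⟨ψ₂, ⟨hn2, hgs2⟩, hk⟩ := key ⌈(-a) / s⌉₊ g₂ g₃ h2 h23 h3 hlen ψ₃ ⟨hn3, hgs3⟩
  exact ⟨ψ₂, hn2, hgs2, hk⟩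

/-- **The split of the deciding crux** (crux-strategist, BC2 redirect): `CooperThreshold` (Kohn–Luttinger
supercriticality: every-GS divergence of the torus pair susceptibility at one repulsive-shifted coupling `g₀ < 0`),
`IncipientOrderPropagation` (sharpness, weak form: divergence at `g₀` ⇒ incipient order `θ_L ≥ 1/L` for every
ground state at every coupling `≥ g₀ + Δ`) and `LocalConvexStep` (BCS convexity of the Cooper coordinate over short
coupling steps in the incipiently ordered regime) imply `CooperCoordinateGrowth` (with threshold coupling `g₀/2`):
the local step is telescoped over `⌈|g₀|/(2s)⌉` steps with slack `⌈|g₀|/(2s)⌉ · |η_L| → 0`, its incipient-order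
premise being discharged on `[g₀/2, 0]` by the propagation fed with the threshold's divergence. [folklore] -/
theorem cooperCoordinateGrowth_of_subs
    (hT : CooperThreshold) (hR : IncipientOrderPropagation) (hV : LocalConvexStep) :
    CooperCoordinateGrowth := by
  obtain ⟨U₁, hU₁, γ₁, hγ₁, hR⟩ := hR
  obtain ⟨U₂, hU₂, γ₂, hγ₂, hV⟩ := hV
  obtain ⟨U, hU, δ, hδ, g₀, hg₀, hdiv⟩ := hT (min U₁ U₂) (lt_min hU₁ hU₂) (min γ₁ γ₂) (lt_min hγ₁ hγ₂)
  have hUR : U ∈ Set.Ioo (0:ℝ) U₁ := ⟨hU.1, lt_of_lt_of_le hU.2 (min_le_left _ _)⟩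
  have hUV : U ∈ Set.Ioo (0:ℝ) U₂ := ⟨hU.1, lt_of_lt_of_le hU.2 (min_le_right _ _)⟩
  have hγle₁ : min γ₁ γ₂ ≤ γ₁ := min_le_left _ _
  have hγle₂ : min γ₁ γ₂ ≤ γ₂ := min_le_right _ _
  have hg₀R : g₀ ∈ Set.Ico (-γ₁) (0:ℝ) := ⟨by linarith [hg₀.1], hg₀.2⟩
  have hg₀neg : g₀ < 0 := hg₀.2
  obtain ⟨L₁, hinc⟩ := hR U hUR δ hδ g₀ hg₀R hdiv (-g₀ / 2) (by linarith)
  obtain ⟨s, hs, b, hb, η, hη, L₀, hstep⟩ := hV U hUV δ hδ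
  have core := split_growth_core U δ (-γ₂) (g₀ / 2) s b η L₀ L₁ (by linarith [hg₀.1]) hs
    (fun L _ hL hE g hg hg0 ψ hψ hgs => hinc L hL hE g (by linarith) hg0 ψ hψ hgs) hstep
  refine ⟨U, hU.1, δ, hδ, g₀ / 2, by linarith, b, hb, fun L => (⌈(-(g₀ / 2)) / s⌉₊ : ℝ) * |η L|, ?_,
    max L₀ L₁, ?_⟩
  · simpa using (hη.abs).const_mul (⌈(-(g₀ / 2)) / s⌉₊ : ℝ)
  · intro L _ hL hEven g₂ g₃ h2 h23 h3 ψ₃ hn3 hgs3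
    exact core L hL hEven g₂ g₃ h2 h23 h3 ψ₃ hn3 hgs3

/-- The same two pieces also derive the route's rank-2 crux `SharpnessDichotomy` (its divergence hypothesis plays the
role of `CooperThreshold`): the foreseen glued split `SharpnessDichotomy ⇐ (propagation) + (convex clause)`. [folklore] -/
theorem sharpnessDichotomy_of_subs (hR : IncipientOrderPropagation) (hV : LocalConvexStep) :
    SharpnessDichotomy := by
  obtain ⟨U₁, hU₁, γ₁, hγ₁, hR⟩ := hR
  obtain ⟨U₂, hU₂, γ₂, hγ₂, hV⟩ := hV
  refine ⟨min U₁ U₂, lt_min hU₁ hU₂, min γ₁ γ₂, lt_min hγ₁ hγ₂, ?_⟩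
  intro U hU δ hδ g₀ hg₀ hdiv
  have hUR : U ∈ Set.Ioo (0:ℝ) U₁ := ⟨hU.1, lt_of_lt_of_le hU.2 (min_le_left _ _)⟩
  have hUV : U ∈ Set.Ioo (0:ℝ) U₂ := ⟨hU.1, lt_of_lt_of_le hU.2 (min_le_right _ _)⟩
  have hγle₁ : min γ₁ γ₂ ≤ γ₁ := min_le_left _ _
  have hγle₂ : min γ₁ γ₂ ≤ γ₂ := min_le_right _ _
  have hg₀R : g₀ ∈ Set.Ico (-γ₁) (0:ℝ) := ⟨by linarith [hg₀.1], hg₀.2⟩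
  have hg₀neg : g₀ < 0 := hg₀.2
  obtain ⟨L₁, hinc⟩ := hR U hUR δ hδ g₀ hg₀R hdiv (-g₀ / 2) (by linarith)
  obtain ⟨s, hs, b, hb, η, hη, L₀, hstep⟩ := hV U hUV δ hδ
  have core := split_growth_core U δ (-γ₂) (g₀ / 2) s b η L₀ L₁ (by linarith [hg₀.1]) hs
    (fun L _ hL hE g hg hg0 ψ hψ hgs => hinc L hL hE g (by linarith) hg0 ψ hψ hgs) hstep
  refine ⟨b, hb, fun L => (⌈(-(g₀ / 2)) / s⌉₊ : ℝ) * |η L|, ?_, max L₀ L₁, ?_⟩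
  · simpa using (hη.abs).const_mul (⌈(-(g₀ / 2)) / s⌉₊ : ℝ)
  · intro L _ hL hEven g₂ g₃ h2 h23 h3 ψ₃ hn3 hgs3
    exact core L hL hEven g₂ g₃ h2 h23 h3 ψ₃ hn3 hgs3

/-- The glue item of the split, BY NAME (route file rev 7): `CooperThreshold → IncipientOrderPropagation →
LocalConvexStep → CooperCoordinateGrowth`. [folklore] -/
theorem cooperCoordinateGrowthOfSubs_proof : CooperCoordinateGrowthOfSubs :=
  fun hT hR hV => cooperCoordinateGrowth_of_subs hT hR hV

/-- The second glue item, BY NAME: `IncipientOrderPropagation → LocalConvexStep → SharpnessDichotomy`. [folklore] -/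
theorem sharpnessDichotomyOfSubs_proof : SharpnessDichotomyOfSubs :=
  fun hR hV => sharpnessDichotomy_of_subs hR hV

end Summit.HubbardSuperconductivity.HubbardSuperconductivity.Theorems.CooperSharpness
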